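import Summits.ResolutionOfSingularities.ResolutionOfSingularities.Theorems.CurveCutKernels
import Literature.AlgebraicGeometry.Resolution.OneDimensionalBlowupTowerStep
import Literature.AlgebraicGeometry.Resolution.FiniteNormalizationGRing
import Literature.AlgebraicGeometry.Resolution.NearPointTauOrigin
import Literature.AlgebraicGeometry.Resolution.BlowupStalkCharts
import Literature.AlgebraicGeometry.Resolution.RegularCentreRsopPart
import HarnessLib

/-!
# CurveChainCutKernels — decomp-res node «CurveChainCut» (lens-4 g37, critic row 209 CLEARED), tree file 1/4 of the node

Content VERBATIM from the decomp-res lens-4 g37 node `HOME/decomp-res-lens-4/g37/CurveChainCut.lean` (pin 33fe29d0 =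
PIN STATUS :1817, 891 l; HOME = run/shared/lean/pub/decomp-res): NO carry — the node imports the LANDED tree only
(g35 «CurveCut» = `Theorems/CurveCutKernels`…, g36 «IsoCompanionCut» = `Theorems/IsoCompanionCutKernels` ·
`IsoCompanionCutCells`, landed 2026-08-31 by writer g13; Literature `OneDimensionalBlowupTowerStep`,
`FiniteNormalizationGRing`, `NearPointTauOrigin`, `BlowupStalkCharts`, `RegularCentreRsopPart`); every declaration
is new, same namespace `…Theorems.HugValuationCut`.  Farm (node; lens + critic runs): rc 0 · 0 err · 0 warn · 0
sorry; `--axioms` std on the law / δ-descent / bridge / decided cell / re-location; FILE A alone rc 0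
(`bc/FileA.check.json`).  Critic: CRITIC-LEDGER row 209 «CurveChainCut» CLEARED (PRICED DELIVERY under the row-203
lane (NP-C″)(a) as adapted (A1)/(A2), NOTE 10:20:38Z (h1)–(h7)): THE LOCATED RESIDUAL CORE C₃♮ʳ («ruled-recurrent
occult divisorial threefold tower following no line», g36) CUT BY THE CURVE LETTER (CF∞) **`FollowsCurveTower`**
(«from some stage on the marked points run along the strict transforms of ONE (possibly SINGULAR) curve germ») and
THE CURVE-FOLLOWING LAW **`noTower_threefold_followsCurve`** PROVED IN KERNEL, HYPOTHESIS-FREE AND PORT-FREE (every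
`p`, field, class `P`, weight `n`, regular and singular germs alike) — two kernel halves: (T) embedded resolution of
the followed germ by the tower's own point blow-ups via δ-DESCENT (`exists_regular_curveStage`; Literature
`isQuadraticTransform_range_branchMap`, `IsQuadraticTransform.curveDelta_lt`, finite normalisation from the G-ring
property of the stalks) and (A) THE LINE BRIDGE (`followsLineTower_of_regular_curveStage`, Literature
`exists_isRsopPart_fin_span_range_eq` / `isRegularLocalRing_and_span_originFamily`), closed by the g35
line-following law `noTower_threefold_followsLine` BY NAME; then the EXACT cut of C₃♮ʳ into C₃♮ʳ ∧ (CF∞) — DECIDED: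
EMPTY, hyp-free, port-free (`wildOccultDivisorialThreefoldNonLineRecurrentCompanionCurveBoundMixed_holds`; indeed
`wildThreefoldCurveBound_holds` for any class) — and C₃♮ʳ ∧ ¬(CF∞) — UNDECIDED · IDEA-NEEDED, the new LOCATED
RESIDUAL **`NoWildOccultCurveFreeRecurrentCompanionNonLineMixedTowers`** = (C₃♮ʳ ∧ ¬CF∞) ∧ C₄ ∧ D₄ —, with the exact
re-locations `…_iff_g37` (hyp-free) / `…_iff_g37_of_port` (the port `h640 : SurfaceChainPort` is INHERITED from the
g36/g35 re-locations, never used by the new law) and the shift-invariance lemmas `curveChain_shift` /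
`curveChain_dim_eq_one` / `followsCurveTower_shift` ((h5)).  HONESTY CLAUSE carried verbatim (no «(CF∞) ⊇ (N∞)» and
no «¬(CF∞) = kangaroo core» asserted); TRANSCRIPTION NOTICE carried verbatim (§119a `curveBranchRing_facts` /
`curveBranch_step_ker` are single-prime transcriptions of conjuncts of Literature `branchRing_facts` /
`branch_step`; a separate 0-weight Literature rider exports the single-prime core — not waited for).  Landing orders
= critic rider INBOX 2026-08-31T10:47:47Z = the NODE landing form: FILE A `CurveChainCutKernels` = §118–§119 cut at
the `section` boundaries into `Kernels` (CurveLetter + CurveRing) / `Kernels2` (CurveStalk) / `Kernels3` (CurveLaw),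
FILE B `CurveChainCutCells` = §120 (imports `Kernels3` + `IsoCompanionCutCells`; cells tagged cn26); all VERBATIM,
cone-free, `--kind proof --supports stmt-ResolutionOfSingularities-28338`; no Theses-cone file; route HugValuation /
lens-4 aside 26902: NO switch (docstring mention only).  The `def … : Prop` declarations (`FollowsCurveTower`,
`WildOccultDivisorialThreefoldNonLineRecurrentCompanionCurveBoundMixedWallFreeFreshJumpShallowCompanionKangarooTowersTerminate`,
`WildOccultDivisorialThreefoldNonLineRecurrentCompanionCurveFreeMixedWallFreeFreshJumpShallowCompanionKangarooTowersTerminate`,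
`NoWildOccultDivisorialThreefoldNonLineRecurrentCompanionCurveBoundMixedTowers`,
`NoWildOccultDivisorialThreefoldNonLineRecurrentCompanionCurveFreeMixedTowers`,
`NoWildOccultCurveFreeRecurrentCompanionNonLineMixedTowers`) are THIS node's letter / cells (cn26) — none is a vendored fact.

The lens header, verbatim:

> # CurveChainCut — decomp-res-lens-4 g37 node «CurveChainCut» (lane (NP-C″) of CRITIC row 203, with the announced
> adaptations (A1)/(A2) of the PRE-BUILD NOTICE INBOX 2026-08-31T09:56:34Z): THE LOCATED RESIDUAL CORE C₃♮ʳ («the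
> ruled-recurrent occult divisorial threefold tower following no line», g36
`…NonLineRecurrentCompanionMixed…Terminate n`) CUT BY
> THE CURVE LETTER (CF∞) `FollowsCurveTower` «from some stage on the marked points run along the strict transforms of ONE
> (possibly SINGULAR) CURVE GERM: a compatible chain of non-maximal primes `𝔮_i ⊂ 𝒪_{x_i}`, `φ_i⁻¹ 𝔮_{i+1} = 𝔮_i`,
> `dim 𝒪_{x_m}/𝔮_m = 1`» — and THE CURVE-FOLLOWING LAW `noTower_threefold_followsCurve` PROVED IN KERNEL, HYPOTHESIS-FREE AND
> PORT-FREE — every `p`, every field, EVERY class `P`, every weight `n`, REGULAR AND SINGULAR germs alike: NO forced tower of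
> ring dimension 3 follows a curve germ.  Two kernel halves: (T) EMBEDDED RESOLUTION OF THE FOLLOWED GERM BY THE TOWER'S OWN
> POINT BLOW-UPS via δ-DESCENT (`exists_regular_curveStage`: along the chain `𝒪_{x_{i+1}}/𝔮_{i+1}` is a quadratic transform of
> the one-dimensional local domain `𝒪_{x_i}/𝔮_i` IN THE CHART THE TOWER CHOOSES — Literature
`isQuadraticTransform_range_branchMap`
> through the ring-level `curveBranch_step` and the stalk-level `curveChain_stage_step` over `IsBlowup.exists_reesChart_stalk`;
> finite normalisation from the G-ring property of the stalks, `tower_isGRing_stalk` +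
> `module_finite_integralClosure_of_isGRing_of_ringKrullDim_eq_one`; `δ` non-increasing and strictly dropping while singular,
> Literature `IsQuadraticTransform.curveDelta_lt` — Kollár 2007 §1.4 Alg. 1.100 / Thm. 1.101 for the GIVEN point sequence, not
> for a chosen one) and (A) THE LINE BRIDGE (`followsLineTower_of_regular_curveStage`: at a stage where `𝒪_{x_i}/𝔮_i` is
> regular, `𝔮_i = (y₂, y₃)` extends to a regular system of parameters `(u; y₂, y₃)` — Literature
> `exists_isRsopPart_fin_span_range_eq` —, the chart at `x_{i+1}` is FORCED to be the `u`-chart at its ORIGIN with parameters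
> `(u; y₂/u, y₃/u)`, `y_l/u ∈ 𝔮_{i+1}` — `curveLine_step` over Literature `isRegularLocalRing_and_span_originFamily` — so by
> dependent choice the tower FOLLOWS A LINE, `FollowsLineTower` g35), closed by the g35 LINE-FOLLOWING LAW
> `noTower_threefold_followsLine` BY NAME (tree `Theorems/CurveCutKernels`).
>
> Then THE CUT OF THE CORE C₃♮ʳ EXACTLY (excluded middle on the letter) into
>   C₃♮ʳ ∧ (CF∞)  — DECIDED: EMPTY, HYPOTHESIS-FREE, PORT-FREE
(`wildOccultDivisorialThreefoldNonLineRecurrentCompanionCurveBoundMixed_holds`;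
>                   indeed (CF∞) is killed in the WHOLE rd-3 column for any class, `wildThreefoldCurveBound_holds`),
>   C₃♮ʳ ∧ ¬(CF∞) — UNDECIDED · IDEA-NEEDED: THE CURVE-FREE RULED-RECURRENT CORE «leaves every curve germ» (for every stage `m`
>                   and every curve chain from `m` some later point is OFF the strict transform; unfolded
`not_followsCurveTower_iff`),
>                   the new LOCATED RESIDUAL of the column by name `NoWildOccultCurveFreeRecurrentCompanionNonLineMixedTowers`
>                   = (C₃♮ʳ ∧ ¬CF∞) ∧ C₄ ∧ D₄,
> with the exact re-locations `…_iff_g37` of C₃♮ʳ (HYPOTHESIS-FREE) and `…_iff_g37_of_port` of C₃♮, C₃, C and of the g35 / g34 /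
> g33 / g32 / g31 residuals (the port `h640` is INHERITED from the g36/g35 re-locations and carried explicitly; the
new law never
> uses it), down-links hypothesis-free, up-link to g36 hypothesis-free.
>
> ADAPTATIONS (announced before the build, INBOX 09:56:34Z; ANSWERED by decomp-res-crit-1 g8, STATUS NOTE 10:20:38Z: NO
> OBJECTION, price conditions (h1)–(h7)).  (A1) THE LETTER IS (CF∞) «follows SOME curve germ», not (N∞) «x_j non-isolated in
> `Top(h_j, a)` for all later j»: (CF∞) is exactly what the line bridge consumes, it needs no near-locus structure
lemma, its cut
> is exact by em, and its kill is PORT-FREE ON BOTH the regular and the SINGULAR germ (the window allowed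
DECIDED-MOD-PORT(CurveLaw)
> for singular Γ; none is used — (M-CurveLaw) stays registered, undischarged, unused).  HONESTY CLAUSE (crit-1 g8): this node
> does NOT assert «(CF∞) ⊇ the (N∞)-intent» nor «¬(CF∞) is the kangaroo core (E-rec) in sharper form» as facts.
What ¬(CF∞) says is
> its letter and nothing more: «for every stage `m` and every curve chain from `m`, the dimension at `m` is not one» — the tower
> ESCAPES EVERY CURVE GERM (`not_followsCurveTower_iff`).  The readings (N∞) ⇒ (CF∞) (near-locus structure lemma «`Top(h_j,a)`
> non-isolated at `x_j` in rd 3 ⇒ a finite union of curves through `x_j`» + a finiteness/König selection of ONE germ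
followed for
> ever) and hence «curve-free core ⊆ exceptional-recurrent side» are INTENDED · UNPROVED, the typed next target (NEXT-g38).
> (A2) PORT-FREE: no `CurveLaw n`, no `SurfaceChainPort` in the new law; the only typed inputs are Literature
theorems (sorry-free)
> and tree theorems BY NAME.  SHIFT-INVARIANCE OF THE LETTER as lemmas (crit-1 g8 (h5)): `curveChain_shift`
(re-indexing to a later
> first stage, `rfl` on the stalks), `curveChain_dim_eq_one` (dimension one + finite normalisation PERSIST along the chain),
> `followsCurveTower_shift` (a tower following a germ from `m` follows one from beyond any `m₀`).
>
> [… the lens header continues (30 more lines: the adaptations (A1)/(A2) and the honesty clause, the TRANSCRIPTION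
NOTICE, why (CF∞) is not letters-excluded, the honest tags, the landing form, sources) in the HOME node file
`HOME/decomp-res-lens-4/g37/CurveChainCut.lean` lines 9–84 — summarised in the provenance paragraph above, not repeated here.]

## This file

§118 (g37 · NEW · LETTER) THE CURVE-CHAIN LETTER (CF∞) **`FollowsCurveTower T`** (`section CurveLetter`): from some
stage `m` on a compatible chain of non-maximal primes `𝔮_i ⊂ 𝒪_{x_i}`, `φ_i⁻¹ 𝔮_{i+1} = 𝔮_i`, `dim 𝒪_{x_m}/𝔮_m = 1`
— the tower follows ONE (possibly singular) curve germ for ever; §119a (`section CurveRing`) RING LEVEL: the branch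
of a local blow-up chart along ONE prime (`curveBranchRing_facts`, `curveBranch_step_ker` — single-prime
transcriptions of conjuncts of Literature `branchRing_facts` / `branch_step`, see the TRANSCRIPTION NOTICE — and
`curveBranch_step`: the quotient along the chain is a quadratic transform of the one-dimensional local domain IN THE
CHART THE TOWER CHOOSES, Literature `isQuadraticTransform_range_branchMap`).  (The 400-line cap cuts this group into
3 files; this first part carries: `FollowsCurveTower`, `eq_ker_chartBranchMap`, `curveBranchRing_facts`,
`curveBranch_step_ker`, `curveBranch_step`.)

[WRITER NOTE (decomp-res writer g13): file split only, at the node's own `══ FILE` markers and `section` boundaries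
(tree files ≤ 400 lines); namespace, sections, section variables and every declaration exactly as in the lens; the
node's two `set_option linter.…` lines, `noncomputable section`, the namespace-level `open` lines and `universe u`
are replayed in every part (critic rider).]

(Sources: Kollar2007 §1.4 (Alg. 1.100, Thm. 1.101); CossartPiltant2008 Lemma 4.3 (3), Prop. 4.4; Matsumura1987 Thms.
14.2, 14.3, 17.8, 32.4; CossartJannsenSaito2020 §6; Hironaka1964 Ch. III; Hauser2010Kangaroo; StacksProject 07PJ / 0C4N / 032E.)
-/

set_option linter.dupNamespace false
set_option linter.unusedSectionVars false

noncomputable section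

open CategoryTheory AlgebraicGeometry IsLocalRing TopologicalSpace
open Literature.AlgebraicGeometry.Resolution
open Summit.ResolutionOfSingularities.ResolutionOfSingularities.Theorems
open WeakOrderReduction ForcedTowerClasses DivergentTowerClasses MonomialTowerClasses
open HugDimensionClasses HugDimensionKernels SurfaceShadowClasses SurfaceShadowKernels
open NearPointCut (SingularClass)
open Scheme.IdealSheafData (vanishingIdeal)
open scoped BigOperators

universe u

namespace Summit.ResolutionOfSingularities.ResolutionOfSingularities.Theorems.HugValuationCut

section CurveLetter

/-! ## ══ FILE A `Theorems/CurveChainCutKernels.lean` (§118–§119; cone-free) ══ -/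

/-! ## §118 (g37 · NEW · LETTER) THE CURVE-CHAIN LETTER (CF∞): THE TOWER FOLLOWS ONE CURVE GERM FOR EVER -/

/-- **LETTER (g37 · structural, by mechanism): THE TOWER FOLLOWS A CURVE GERM** — from some stage `m` on there is a
compatible chain of NON-MAXIMAL PRIME IDEALS `𝔮_i ⊂ 𝒪_{X_i, x_i}` (`i ≥ m`), `φ_i⁻¹(𝔮_{i+1}) = 𝔮_i` under the chain maps
`φ_i : 𝒪_{x_i} → 𝒪_{x_{i+1}}` of the blow-ups, with `dim 𝒪_{x_m}/𝔮_m = 1`: the marked points run along the strict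
transforms of ONE (possibly SINGULAR) curve germ `V(𝔮_m) ∋ x_m` for ever (`𝒪_{x_{i+1}}/𝔮_{i+1}` is the local ring of the
strict transform of `V(𝔮_i)` at `x_{i+1}`).  Absolute indexing (`lineRing T i 0 = 𝒪_{X_i, π_i(x_{i+1})} = 𝒪_{x_i}`,
`lineMap T i 0 = φ_i`, g35 currency).  The g35 line letter `FollowsLineTower` is the REGULAR-germ, regular-parameter form. -/
def FollowsCurveTower (T : ForcedTower) : Prop :=
  ∃ (m : ℕ) (𝔮 : ∀ i, Ideal (lineRing T i 0)),
    (∀ i, m ≤ i → (𝔮 i).IsPrime ∧ 𝔮 i ≠ maximalIdeal (lineRing T i 0) ∧ (𝔮 (i + 1)).comap (lineMap T i 0) = 𝔮 i) ∧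
      ringKrullDim (lineRing T m 0 ⧸ 𝔮 m) = 1

end CurveLetter

section CurveRing

variable {R : Type u} [CommRing R]

/-! ## §119 (g37 · NEW · KERNEL) THE CURVE-FOLLOWING LAW: NO FORCED THREEFOLD TOWER FOLLOWS A CURVE GERM (PORT-FREE)

Two kernel halves.  (T) EMBEDDED CURVE RESOLUTION ALONG THE CHAIN BY δ-DESCENT: along a curve chain the branch `V(𝔮_{i+1})`
of `𝒪_{x_{i+1}}` is a QUADRATIC TRANSFORM of the one-dimensional local domain `𝒪_{x_i}/𝔮_i` (Literature
`isQuadraticTransform_range_branchMap`, for the GIVEN blow-up chart, whatever point the tower chooses), so the δ-invariant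
`δ(𝒪_{x_i}/𝔮_i) = length(normalisation/ring)` (finite: the stalks are G-rings, `tower_isGRing_stalk`,
`module_finite_integralClosure_of_isGRing_of_ringKrullDim_eq_one`) is NON-INCREASING and drops strictly unless
`𝒪_{x_i}/𝔮_i` is already regular (Literature `IsQuadraticTransform.curveDelta_lt`; Kollár 2007 §1.4, Alg. 1.100 /
Thm. 1.101): after finitely many stages THE CURVE GERM IS REGULAR.  (A) THE LINE BRIDGE: at a stage where `𝒪_{x_i}/𝔮_i` is
regular, `𝔮_i = (y₂, y₃)` is generated by part of a regular system of parameters `(u; y₂, y₃)` (Literature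
`exists_isRsopPart_fin_span_range_eq`), the blow-up chart at `x_{i+1}` is FORCED to be the `u`-chart (`c_j ∈ 𝔮_i` for
`j ≠ 0` would put `u` into `𝔮_i`), the next point is the ORIGIN of that chart (`y_l/u ∈ 𝔮_{i+1} ⊆ 𝔪_{x_{i+1}}`), and
`(u; y₂/u, y₃/u)` is a regular system of parameters there (Literature `isRegularLocalRing_and_span_originFamily`) with
`y₂/u, y₃/u ∈ 𝔮_{i+1}` — by dependent choice the tower FOLLOWS A LINE from stage `i` on (`FollowsLineTower`, g35), which
the LINE-FOLLOWING LAW `noTower_threefold_followsLine` (g35, kernel, port-free) forbids.  Every `p`, every field, every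
class `P`, every weight `n`; NO port, NO typed fact as hypothesis. -/

/-! ### §119a ring level: the branch of a local blow-up chart along ONE prime -/

/-- a prime `P` of the blow-up chart `R[𝔪/c_i]` lying over the prime `q ∌ c_i` IS the strict transform `ker θ_{q,i}` of the
branch `V(q)` (both are the unique prime over `q` off `V(c_i)`: `c_i^k b ∈ image of R`). [folklore; Kollar2007 §1.4]
[folklore] -/
theorem eq_ker_chartBranchMap {k : ℕ} (c : Fin k → R) (i : Fin k) (q : Ideal R) [q.IsPrime] (hq : c i ∉ q)
    (P : Ideal (chartRing c i)) [P.IsPrime] (hP : P.comap (chartBase c i) = q) :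
    P = RingHom.ker (chartBranchMap c i q hq) := by
  have hci : chartBase c i (c i) ∉ P := fun h => hq (by rw [← hP]; exact h)
  have hθci : chartBranchMap c i q hq (chartBase c i (c i)) ≠ 0 := by
    rw [chartToField_reesChartBase]; exact (branchPoint_ne_zero_iff q _).mpr hq
  ext b
  obtain ⟨k, r, hkr0⟩ := exists_pow_mul_eq_reesChartBase c i b
  have hkr : chartBase c i (c i) ^ k * b = chartBase c i r := hkr0
  have h1 : b ∈ P ↔ r ∈ q := by
    constructor
    · intro hb
      have : chartBase c i r ∈ P := by rw [← hkr]; exact Ideal.mul_mem_left _ _ hb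
      rw [← hP]; exact this
    · intro hr
      have hr' : chartBase c i (c i) ^ k * b ∈ P := by rw [hkr, ← Ideal.mem_comap, hP]; exact hr
      rcases (Ideal.IsPrime.mem_or_mem ‹P.IsPrime› hr') with h | h
      · exact absurd (Ideal.IsPrime.mem_of_pow_mem ‹P.IsPrime› k h) hci
      · exact h
  have hθ : chartBranchMap c i q hq (chartBase c i (c i)) ^ k * chartBranchMap c i q hq b = branchPoint q r := by
    rw [← map_pow, ← map_mul, hkr]; exact chartToField_reesChartBase c i _ _ r
  have h2 : b ∈ RingHom.ker (chartBranchMap c i q hq) ↔ r ∈ q := by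
    rw [RingHom.mem_ker, ← branchPoint_eq_zero_iff q r, ← hθ]
    exact (mul_eq_zero_iff_left (pow_ne_zero k hθci)).symm
  exact h1.trans h2.symm

variable [IsLocalRing R] [IsNoetherianRing R]
  {k : ℕ} (c : Fin k → R) (hc : Ideal.span (Set.range c) = maximalIdeal R) (i : Fin k)
  (𝔴 : Ideal (chartRing c i)) [𝔴.IsPrime] (h𝔴 : 𝔴.comap (chartBase c i) = maximalIdeal R)
  (S : Type u) [CommRing S] [IsLocalRing S] [Algebra (chartRing c i) S] [IsLocalization.AtPrime S 𝔴]

/-- the branch ring `θ_q(R) ≅ R/q` of ONE prime `q` with `dim R/q = 1` and finite normalisation: Noetherian, one-dimensional,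
not a field, a local ring OF `Frac(R/q)`, with finite normalisation (single-prime form of the Literature lemma
`branchRing_facts`, whose hypotheses quantify over the minimal primes of a reduced ring). [folklore; Kollar2007
§1.4] [folklore] -/
theorem curveBranchRing_facts (q : Ideal R) [q.IsPrime] (hdq : ringKrullDim (R ⧸ q) = 1)
    (hfq : Module.Finite (R ⧸ q) (integralClosure (R ⧸ q) (FractionRing (R ⧸ q)))) :
    haveI := isLocalRing_range_branchPoint q (R := R)
    IsNoetherianRing (branchPoint q).range ∧ ringKrullDim (branchPoint q).range = 1 ∧
      ¬ IsField (branchPoint q).range ∧ IsLocalRingOf (branchPoint q).range ∧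
      IsFractionRing (branchPoint q).range (FractionRing (R ⧸ q)) ∧
      Module.Finite (branchPoint q).range
        (integralClosure (branchPoint q).range (FractionRing (R ⧸ q))) := by
  haveI := isLocalRing_range_branchPoint q (R := R)
  have e := quotientEquivRangeBranchPoint q (R := R)
  have hN : IsNoetherianRing (branchPoint q).range := isNoetherianRing_of_ringEquiv _ e
  have hd : ringKrullDim (branchPoint q).range = 1 := by
    rw [← ringKrullDim_eq_of_ringEquiv e]; exact hdq
  have hof := isLocalRingOf_range_branchPoint q (R := R)
  haveI hfr : IsFractionRing (branchPoint q).range (FractionRing (R ⧸ q)) :=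
    isFractionRing_of_isLocalRingOf_le hof.2 le_rfl
  haveI := hfq
  have hF : Module.Finite (branchPoint q).range
      (integralClosure (branchPoint q).range (FractionRing (R ⧸ q))) :=
    module_finite_integralClosure_of_ringEquiv e (FractionRing (R ⧸ q)) (FractionRing (R ⧸ q))
  exact ⟨hN, hd, (ringKrullDim_eq_one_iff_of_isLocalRing_isDomain.mp hd).1, hof, hfr, hF⟩

include hc h𝔴 in
/-- **the branch of `S = R[𝔪/c_i]_𝔴` along ONE prime `q` (`dim R/q = 1`, finite normalisation, `c_i ∉ q`, the branch
passing through `𝔴`)**: with `𝔔 = ker ψ_q`, `S/𝔔 ≅ ψ_q(S)` is a quadratic transform of `θ_q(R) ≅ R/q`, hence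
one-dimensional with finite normalisation, `δ(S/𝔔) ≤ δ(R/q)`, with equality only if `R/q` is regular (single-prime form of
the first four conjuncts of the Literature theorem `branch_step`; same proof). (Sources: Kollar2007, §1.4, Alg.
1.100, Thm. 1.101.) -/
theorem curveBranch_step_ker (q : Ideal R) [q.IsPrime] (hdq : ringKrullDim (R ⧸ q) = 1)
    (hfq : Module.Finite (R ⧸ q) (integralClosure (R ⧸ q) (FractionRing (R ⧸ q)))) (hq : c i ∉ q)
    (hpass : RingHom.ker (chartBranchMap c i q hq) ≤ 𝔴) :
    ringKrullDim (S ⧸ RingHom.ker (branchMap c i q hq 𝔴 S hpass)) = 1 ∧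
    (haveI : (RingHom.ker (branchMap c i q hq 𝔴 S hpass)).IsPrime := RingHom.ker_isPrime _
     Module.Finite (S ⧸ RingHom.ker (branchMap c i q hq 𝔴 S hpass))
      (integralClosure (S ⧸ RingHom.ker (branchMap c i q hq 𝔴 S hpass))
        (FractionRing (S ⧸ RingHom.ker (branchMap c i q hq 𝔴 S hpass))))) ∧
    branchDelta S (RingHom.ker (branchMap c i q hq 𝔴 S hpass)) ≤ branchDelta R q ∧
    (branchDelta S (RingHom.ker (branchMap c i q hq 𝔴 S hpass)) = branchDelta R q →
      IsRegularLocalRing (R ⧸ q)) := by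
  -- the branch ring `A = θ_q(R)` and its data
  haveI := isLocalRing_range_branchPoint q (R := R)
  obtain ⟨hN, hdA, hDA, hof, hfr, hF⟩ := curveBranchRing_facts q hdq hfq
  haveI := hN; haveI := hfr; haveI := hF
  haveI : IsDedekindDomain (integralClosure (branchPoint q).range (FractionRing (R ⧸ q))) :=
    isDedekindDomain_integralClosure_of_module_finite _ _ hdA.le
  haveI : IsFractionRing (integralClosure (branchPoint q).range (FractionRing (R ⧸ q)))
      (FractionRing (R ⧸ q)) := isFractionRing_integralClosure _ _
  -- the quadratic transform `D₁ = ψ_q(S)` and `S/𝔔 ≅ D₁`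
  set ψ := branchMap c i q hq 𝔴 S hpass with hψ
  have hQT : IsQuadraticTransform (branchPoint q).range ψ.range :=
    isQuadraticTransform_range_branchMap c i hc q hq 𝔴 h𝔴 S hpass
  haveI : IsLocalRing ψ.range := hQT.isLocalRing
  haveI hfr₁ : IsFractionRing ψ.range (FractionRing (R ⧸ q)) :=
    isFractionRing_of_isLocalRingOf_le hof.2 hQT.le'
  haveI : (RingHom.ker ψ).IsPrime := RingHom.ker_isPrime _
  -- an explicit model of `S/𝔔 ≅ ψ(S)` computing on representatives
  let f₀ : S ⧸ RingHom.ker ψ →+* ψ.range :=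
    Ideal.Quotient.lift (RingHom.ker ψ) ψ.rangeRestrict fun a ha =>
      Subtype.ext (by rw [RingHom.coe_rangeRestrict, (RingHom.mem_ker).mp ha]; rfl)
  have hf₀mk : ∀ s : S, f₀ (Ideal.Quotient.mk _ s) = ψ.rangeRestrict s := fun s => rfl
  have hf₀ : Function.Bijective f₀ := by
    refine ⟨(injective_iff_map_eq_zero f₀).mpr fun x hx => ?_, fun y => ?_⟩
    · obtain ⟨s, rfl⟩ := Ideal.Quotient.mk_surjective x
      rw [hf₀mk] at hx
      exact Ideal.Quotient.eq_zero_iff_mem.mpr ((RingHom.mem_ker).mpr (congrArg Subtype.val hx))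
    · obtain ⟨s, hs⟩ := ψ.rangeRestrict_surjective y
      exact ⟨Ideal.Quotient.mk _ s, by rw [hf₀mk, hs]⟩
  let e₁ : S ⧸ RingHom.ker ψ ≃+* ψ.range := RingEquiv.ofBijective f₀ hf₀
  refine ⟨?_, ?_, ?_, ?_⟩
  · rw [ringKrullDim_eq_of_ringEquiv e₁]; exact hQT.ringKrullDim_eq_one hof hDA hdA
  · haveI := hQT.module_finite_integralClosure hof
    exact module_finite_integralClosure_of_ringEquiv e₁.symm (FractionRing (R ⧸ q)) _
  · -- `δ(S/𝔔) = δ(D₁) ≤ δ(A) = δ(R/q)`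
    rw [branchDelta_eq, branchDelta_eq, curveDelta_eq_of_ringEquiv e₁ _ (FractionRing (R ⧸ q)),
      curveDelta_eq_of_ringEquiv (quotientEquivRangeBranchPoint q (R := R)) _ (FractionRing (R ⧸ q))]
    by_cases hDVR : IsDiscreteValuationRing (branchPoint q).range
    · have heq : ψ.range = (branchPoint q).range := hQT.eq_self_of_isDiscreteValuationRing
      exact (curveDelta_eq_of_ringEquiv (RingEquiv.subringCongr heq) (FractionRing (R ⧸ q))
        (FractionRing (R ⧸ q))).le
    · exact (hQT.curveDelta_lt hof hDA hdA hDVR).le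
  · -- equality forces `A` to be a discrete valuation ring
    intro heq
    rw [branchDelta_eq, branchDelta_eq, curveDelta_eq_of_ringEquiv e₁ _ (FractionRing (R ⧸ q)),
      curveDelta_eq_of_ringEquiv (quotientEquivRangeBranchPoint q (R := R)) _ (FractionRing (R ⧸ q))]
      at heq
    by_cases hDVR : IsDiscreteValuationRing (branchPoint q).range
    · exact IsRegularLocalRing.of_ringEquiv (quotientEquivRangeBranchPoint q (R := R)).symm
    · exact absurd heq (hQT.curveDelta_lt hof hDA hdA hDVR).ne

include hc h𝔴 in
/-- **the branch step for a GIVEN prime `Q` of `S` over the strict transform `ker θ_{q,i}`** (`Q ∩ R[𝔪/c_i] = ker θ_{q,i}`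
forces `Q = ker ψ_q`, the primes of the localisation `S` being determined by their contractions). (Sources:
Kollar2007, §1.4.) -/
theorem curveBranch_step (q : Ideal R) [q.IsPrime] (hdq : ringKrullDim (R ⧸ q) = 1)
    (hfq : Module.Finite (R ⧸ q) (integralClosure (R ⧸ q) (FractionRing (R ⧸ q)))) (hq : c i ∉ q)
    (Q : Ideal S) [Q.IsPrime] (hQ : Q.comap (algebraMap (chartRing c i) S) = RingHom.ker (chartBranchMap c i q hq)) :
    ringKrullDim (S ⧸ Q) = 1 ∧
      Module.Finite (S ⧸ Q) (integralClosure (S ⧸ Q) (FractionRing (S ⧸ Q))) ∧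
      branchDelta S Q ≤ branchDelta R q ∧ (branchDelta S Q = branchDelta R q → IsRegularLocalRing (R ⧸ q)) := by
  have hpass : RingHom.ker (chartBranchMap c i q hq) ≤ 𝔴 := by
    rw [← hQ, ← IsLocalization.AtPrime.under_maximalIdeal S 𝔴]
    exact Ideal.comap_mono (IsLocalRing.le_maximalIdeal (Ideal.IsPrime.ne_top ‹Q.IsPrime›))
  have hK : (RingHom.ker (branchMap c i q hq 𝔴 S hpass)).comap (algebraMap (chartRing c i) S) =
      RingHom.ker (chartBranchMap c i q hq) := by
    ext b
    simp only [Ideal.mem_comap, RingHom.mem_ker, branchMap_algebraMap]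
  have hQψ : Q = RingHom.ker (branchMap c i q hq 𝔴 S hpass) := by
    rw [← IsLocalization.map_under 𝔴.primeCompl S Q, ← IsLocalization.map_under 𝔴.primeCompl S
      (RingHom.ker (branchMap c i q hq 𝔴 S hpass)), Ideal.under_def, Ideal.under_def, hQ, hK]
  subst hQψ
  obtain ⟨h1, h2, h3, h4⟩ := curveBranch_step_ker c hc i 𝔴 h𝔴 S q hdq hfq hq hpass
  exact ⟨h1, h2, h3, h4⟩

end CurveRing

end Summit.ResolutionOfSingularities.ResolutionOfSingularities.Theorems.HugValuationCut
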